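import Summits.KontsevichZagierPeriods.KontsevichZagierPeriods.Theorems.FermatIsogenyBetaLinearSectorStubTransportInvXAux
import HarnessLib

/-!
# `BetaLinearSector` (stmt-KontsevichZagierPeriods-3897), line `fermat-sector-transport` — SECTOR
# STUB T1 `stub_transportInvX` (transport of Fermat symbols along `g₂(x,y) = (1/x, εy/x)`)

On the affine Fermat curve `F_N = {x^N + y^N = 1}` with Rohrlich's forms
`ω_{r,s} = x^{r−1}y^{s−1}(y dx − x dy)` and `ε = e^{iπ/N}` (`ε^N = −1`), the birational
automorphism `g₂(x, y) = (1/x, εy/x)` satisfies `g₂^*ω_{t,s} = ε^s ω_{r,s}` for `r + s + t = N`.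
In the elementary rendering of Huber–Wüstholz's Theorem 13.3 (2) (`CurvePeriods.lean`, relations
(R1)–(R5)) this reads: for a `C¹` path `δ` on `F_N` avoiding `x = 0` on `[0,1]` and
`δ′ = g₂ ∘ δ` there, `(F_N, ω_{r,s}, δ) − ε̄^s · (F_N, ω_{t,s}, δ′)` is a `ℚ̄`-combination of
elementary relations (`stub_transportInvX`, the registered signature of the skeleton's stub T1).

Proof: through the smooth affine curve `Z_N = {x^N + y^N = 1, xu = 1} ⊂ 𝔸³` of the companion
file `…StubTransportInvXAux.lean` with its polynomial maps `p = (x, y)`, `q = (u, εyu) : Z_N → F_N`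
and the lifted path `δ″ = (δ_x, δ_y, 1/δ_x)` (`p ∘ δ″ = δ`, `q ∘ δ″ = δ′` on `[0,1]`): (R4) twice,
then (R1) (`add`, `smul`) and (R2) (`vanish`) for `p^*ω_{r,s} = ε̄^s q^*ω_{t,s} + V`, `V = 0` on
`Z_N` (`transportInvX_vanishesOn`).

References: B. Gross (appendix by D. Rohrlich), *On the periods of abelian integrals and a formula
of Chowla and Selberg*, Invent. Math. 45 (1978), §1; A. Huber, G. Wüstholz, *Transcendence and
Linear Relations of 1-Periods* (2022), §3.3.1 and §13.1 (B). No definition, no named fact.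
-/

noncomputable section

open scoped BigOperators unitInterval
open MeasureTheory Set MvPolynomial
open Literature.NumberTheory.Transcendental Literature.NumberTheory.Transcendental.CurvePeriods

namespace Summit.KontsevichZagierPeriods.FermatIsogeny.BetaLinearSector

/-- SECTOR STUB T1 (transport along `g₂(x,y) = (1/x, εy/x)`, "invert `x`"). For positive `r, s, t`
with `r + s + t = N` and any `C¹` path `δ` on `F_N` avoiding `x = 0` on `[0,1]`, with `δ′ = g₂ ∘ δ`
there (`ε = e^{iπ/N}`): `(F_N, ω_{r,s}, δ) − ε̄^s (F_N, ω_{t,s}, δ′)` is a `ℚ̄`-combination of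
elementary relations. Proof: on the auxiliary smooth affine curve
`Z_N = {x^N + y^N = 1, xu = 1} ⊂ 𝔸³` with the polynomial maps `p = (x, y)`, `q = (u, εyu)` to `F_N`
and the lifted path `δ″ = (δ_x, δ_y, 1/δ_x)` (`p ∘ δ″ = δ`, `q ∘ δ″ = δ′`), (R4) gives
`(Z_N, p^*ω_{r,s}, δ″) ∼ (F_N, ω_{r,s}, δ)` and `(Z_N, q^*ω_{t,s}, δ″) ∼ (F_N, ω_{t,s}, δ′)`; and
`p^*ω_{r,s} − ε̄^s q^*ω_{t,s}` vanishes on `Z_N` (`transportInvX_vanishesOn`), so (R1), (R2) give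
`(Z_N, p^*ω_{r,s}, δ″) ∼ ε̄^s (Z_N, q^*ω_{t,s}, δ″)`.
[cite: HuberWustholz2022, §13.1 (B) (p. 120)] [cite: Gross1978, §1] -/
theorem stub_transportInvX : ∀ (N r s t : ℕ), 1 ≤ r → 1 ≤ s → 1 ≤ t → r + s + t = N →
    ∀ (hZ : (⟨2, 1, ![X 0 ^ N + X 1 ^ N - 1]⟩ : CurveData).IsSmoothAffineCurve)
      (hω : ∀ i, HasAlgCoeffs ((![X 0 ^ (r - 1) * X 1 ^ s, -(X 0 ^ r * X 1 ^ (s - 1))] :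
        Fin 2 → MvPolynomial (Fin 2) ℂ) i))
      (hω' : ∀ i, HasAlgCoeffs ((![X 0 ^ (t - 1) * X 1 ^ s, -(X 0 ^ t * X 1 ^ (s - 1))] :
        Fin 2 → MvPolynomial (Fin 2) ℂ) i))
      (δ δ' : CurvePath (⟨2, 1, ![X 0 ^ N + X 1 ^ N - 1]⟩ : CurveData)),
    (∀ t ∈ Set.Icc (0:ℝ) 1, δ.toFun t 0 ≠ 0) →
    (∀ t ∈ Set.Icc (0:ℝ) 1, δ'.toFun t =
      ![(δ.toFun t 0)⁻¹, Complex.exp (↑Real.pi * Complex.I / (N : ℂ)) * δ.toFun t 1 / δ.toFun t 0]) →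
    ∃ (k : ℕ) (ρ : Fin k → (PeriodSymbol →₀ ℂ)) (a : Fin k → ℂ),
      (∀ l, IsElementaryRelation (ρ l)) ∧ (∀ l, IsAlgebraic ℚ (a l)) ∧
      (Finsupp.single (⟨(⟨2, 1, ![X 0 ^ N + X 1 ^ N - 1]⟩ : CurveData), hZ,
            (![X 0 ^ (r - 1) * X 1 ^ s, -(X 0 ^ r * X 1 ^ (s - 1))] : Fin 2 → MvPolynomial (Fin 2) ℂ), hω, δ⟩ :
            PeriodSymbol) (1 : ℂ) -
          (Complex.exp (-(↑Real.pi * Complex.I / (N : ℂ)))) ^ s •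
            Finsupp.single (⟨(⟨2, 1, ![X 0 ^ N + X 1 ^ N - 1]⟩ : CurveData), hZ,
              (![X 0 ^ (t - 1) * X 1 ^ s, -(X 0 ^ t * X 1 ^ (s - 1))] :
                Fin 2 → MvPolynomial (Fin 2) ℂ), hω', δ'⟩ : PeriodSymbol) (1 : ℂ)) =
        ∑ l, a l • ρ l := by
  intro N r s t hr hs ht hN hZ hω hω' δ δ' hδ hδ'
  have hN1 : 1 ≤ N := by omega
  have hN0 : N ≠ 0 := by omega
  -- names: `Z` the auxiliary curve, `ε`, `εb = ε̄`, the maps `P = p`, `Q = q`, the forms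
  -- `ω₁ = ω_{r,s}`, `ω₂ = ω_{t,s}`
  set Z : CurveData := ⟨3, 2, ![X 0 ^ N + X 1 ^ N - 1, X 0 * X 2 - 1]⟩ with hZdef
  set ε : ℂ := Complex.exp (↑Real.pi * Complex.I / (N : ℂ)) with hε
  set εb : ℂ := Complex.exp (-(↑Real.pi * Complex.I / (N : ℂ))) with hεb
  set P : Fin 2 → MvPolynomial (Fin 3) ℂ := ![X 0, X 1] with hP
  set Q : Fin 2 → MvPolynomial (Fin 3) ℂ := ![X 2, C ε * X 1 * X 2] with hQ
  set ω₁ : Fin 2 → MvPolynomial (Fin 2) ℂ :=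
    ![X 0 ^ (r - 1) * X 1 ^ s, -(X 0 ^ r * X 1 ^ (s - 1))] with hω₁
  set ω₂ : Fin 2 → MvPolynomial (Fin 2) ℂ :=
    ![X 0 ^ (t - 1) * X 1 ^ s, -(X 0 ^ t * X 1 ^ (s - 1))] with hω₂
  have hZ'' : Z.IsSmoothAffineCurve := transportInvX_isSmoothAffineCurve_aux hN1 hZ
  have hεbs : IsAlgebraic ℚ (εb ^ s) := (sectorPaths_algebraic_epsBar hN0).pow s
  have hp : ∀ j, HasAlgCoeffs (P j) := transportInvX_hasAlgCoeffs_p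
  have hq : ∀ j, HasAlgCoeffs (Q j) := transportInvX_hasAlgCoeffs_q (sectorPaths_algebraic_eps hN0)
  -- the lifted path `δ″ = (δ_x, δ_y, 1/δ_x)` on `Z_N`
  obtain ⟨δ'', hδ''⟩ : ∃ δ'' : CurvePath Z,
      ∀ u, δ''.toFun u = ![δ.toFun u 0, δ.toFun u 1, (δ.toFun u 0)⁻¹] :=
    ⟨{ toFun := fun u => ![δ.toFun u 0, δ.toFun u 1, (δ.toFun u 0)⁻¹]
       contDiffOn := by
         refine contDiffOn_pi.2 fun i => ?_
         fin_cases i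
         · simpa using δ.contDiffOn_apply 0
         · simpa using δ.contDiffOn_apply 1
         · exact (δ.contDiffOn_apply 0).inv hδ
       mem_points := fun u hu => by
         have h := (mem_points_fermat_iff N _).1 (δ.mem_points u hu)
         exact (transportInvX_mem_aux_iff N _).2
           ⟨by simpa using h, by simp [mul_inv_cancel₀ (hδ u hu)]⟩
       algebraic_zero := fun i => by
         fin_cases i
         · simpa using δ.algebraic_zero 0
         · simpa using δ.algebraic_zero 1
         · simpa using (δ.algebraic_zero 0).inv
       algebraic_one := fun i => by
         fin_cases i
         · simpa using δ.algebraic_one 0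
         · simpa using δ.algebraic_one 1
         · simpa using (δ.algebraic_one 0).inv }, fun u => rfl⟩
  -- the forms `p^*ω_{r,s}`, `q^*ω_{t,s}`, `ε̄^s q^*ω_{t,s}`, `V` on `Z_N` are over `ℚ̄`
  have hA : ∀ i, HasAlgCoeffs (formPullback P ω₁ i) := HasAlgCoeffs.formPullback hp hω
  have hB : ∀ i, HasAlgCoeffs (formPullback Q ω₂ i) := HasAlgCoeffs.formPullback hq hω'
  have hBs : ∀ i, HasAlgCoeffs ((εb ^ s • formPullback Q ω₂) i) := fun i => (hB i).smul hεbs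
  have hV : ∀ i, HasAlgCoeffs ((formPullback P ω₁ - εb ^ s • formPullback Q ω₂) i) := fun i =>
    (hA i).sub (hBs i)
  -- (R4) along `p` and along `q`
  have r1 := IsElementaryRelation.pushforward Z _ hZ'' hZ P hp (transportInvX_p_mapsTo N) ω₁ hω
    (formPullback P ω₁) hA rfl δ'' δ (fun u _ => by
      rw [hδ'' u]
      funext j
      fin_cases j <;> simp [hP])
  have r2 := IsElementaryRelation.pushforward Z _ hZ'' hZ Q hq
    (transportInvX_q_mapsTo (sectorChart_eps_pow hN0)) ω₂ hω' (formPullback Q ω₂) hB rfl δ'' δ'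
    (fun u hu => by
      rw [hδ' u hu, hδ'' u]
      funext j
      fin_cases j
      · simp [hQ]
      · simp [hQ, hε, div_eq_mul_inv, mul_assoc])
  -- (R1), (R2) on `Z_N`: `p^*ω_{r,s} = ε̄^s q^*ω_{t,s} + V` with `V = 0` in `Ω¹(Z_N)`
  have r3 := IsElementaryRelation.add Z hZ'' δ'' (formPullback P ω₁) (εb ^ s • formPullback Q ω₂)
    (formPullback P ω₁ - εb ^ s • formPullback Q ω₂) hA hBs hV (add_sub_cancel _ _).symm
  have r4 := IsElementaryRelation.smul Z hZ'' δ'' (εb ^ s) hεbs (formPullback Q ω₂)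
    (εb ^ s • formPullback Q ω₂) hB hBs rfl
  have r5 := IsElementaryRelation.vanish Z hZ'' δ'' _ hV
    (transportInvX_vanishesOn hr hs ht hN (sectorChart_eps_mul_epsBar N))
  obtain ⟨k, ρ, a, hρ, ha, he⟩ := span_add (span_add (span_add (span_sub
    (span_smul hεbs (span_of_rel r2)) (span_of_rel r1)) (span_of_rel r3)) (span_of_rel r4))
    (span_of_rel r5)
  refine ⟨k, ρ, a, hρ, ha, ?_⟩
  rw [← he, smul_sub]
  abel

end Summit.KontsevichZagierPeriods.FermatIsogeny.BetaLinearSector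

end
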